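import Mathlib
import Summits.Ventures.PercRepro2.K5Transfer

/-!
# Five distinct marks on a five-element vertex type ARE a marking
(blind cell PercRepro2, typer-1 g9)

`K5Transfer.lean` states (RV), (i), (ii), (J1₁) on an arbitrary five-vertex graph through an equivalence
`ι : V ≃ Fin 5` sending the marks to `0, …, 4`.  Here the equivalence is built from the marks alone
(`exists_equiv_of_five`), so the four theorems are restated with the weight-free hypothesis
`Fintype.card V = 5` and ten inequalities: **`caseOneRV_card5`, `zSplitI_card5`, `zSplitII_card5`,
`jOneOne_card5`** — row 2′J1-RV / (i) / (ii) / (J1₁) on EVERY graph with exactly five vertices, every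
choice of five distinct marks, every weight vector.
-/

namespace Summit.Ventures.PercRepro2

namespace K5

/-- Five distinct elements of a five-element type are the images of `0, …, 4` under some equivalence
with `Fin 5`. -/
lemma exists_equiv_of_five {V : Type*} [Fintype V] [DecidableEq V] (hV : Fintype.card V = 5)
    (o a₁ a₂ a₃ b : V) (h01 : o ≠ a₁) (h02 : o ≠ a₂) (h03 : o ≠ a₃) (h04 : o ≠ b)
    (h12 : a₁ ≠ a₂) (h13 : a₁ ≠ a₃) (h14 : a₁ ≠ b) (h23 : a₂ ≠ a₃) (h24 : a₂ ≠ b) (h34 : a₃ ≠ b) :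
    ∃ ι : V ≃ Fin 5, ι o = 0 ∧ ι a₁ = 1 ∧ ι a₂ = 2 ∧ ι a₃ = 3 ∧ ι b = 4 := by
  let f : Fin 5 → V := ![o, a₁, a₂, a₃, b]
  have hf : Function.Injective f := by
    intro i j hij
    fin_cases i <;> fin_cases j <;> simp [f] at hij ⊢ <;>
      first
      | exact absurd hij h01 | exact absurd hij.symm h01
      | exact absurd hij h02 | exact absurd hij.symm h02
      | exact absurd hij h03 | exact absurd hij.symm h03
      | exact absurd hij h04 | exact absurd hij.symm h04
      | exact absurd hij h12 | exact absurd hij.symm h12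
      | exact absurd hij h13 | exact absurd hij.symm h13
      | exact absurd hij h14 | exact absurd hij.symm h14
      | exact absurd hij h23 | exact absurd hij.symm h23
      | exact absurd hij h24 | exact absurd hij.symm h24
      | exact absurd hij h34 | exact absurd hij.symm h34
  have hbij : Function.Bijective f :=
    (Fintype.bijective_iff_injective_and_card f).2 ⟨hf, by simp [hV]⟩
  refine ⟨(Equiv.ofBijective f hbij).symm, ?_, ?_, ?_, ?_, ?_⟩ <;>
    · rw [Equiv.symm_apply_eq]; rfl

section Theorems

variable {V E : Type*} [Fintype V] [DecidableEq V] [Fintype E] [DecidableEq E]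
variable {R : Type*} [Field R] [LinearOrder R] [IsStrictOrderedRing R]

/-- **(RV) on every graph with exactly five vertices, every five distinct marks, every weight vector.** -/
theorem caseOneRV_card5 (hV : Fintype.card V = 5) (ends : E → Sym2 V) (p : E → R) (hp : IsProbVec p)
    (o a₁ a₂ a₃ b : V) (h01 : o ≠ a₁) (h02 : o ≠ a₂) (h03 : o ≠ a₃) (h04 : o ≠ b)
    (h12 : a₁ ≠ a₂) (h13 : a₁ ≠ a₃) (h14 : a₁ ≠ b) (h23 : a₂ ≠ a₃) (h24 : a₂ ≠ b) (h34 : a₃ ≠ b) :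
    CaseOne.RV p ends o a₁ a₂ a₃ b := by
  obtain ⟨ι, h0, h1, h2, h3, h4⟩ :=
    exists_equiv_of_five hV o a₁ a₂ a₃ b h01 h02 h03 h04 h12 h13 h14 h23 h24 h34
  exact caseOneRV_five ι ends p hp o a₁ a₂ a₃ b h0 h1 h2 h3 h4

/-- **(i) on every graph with exactly five vertices, every five distinct marks, every weight vector.** -/
theorem zSplitI_card5 (hV : Fintype.card V = 5) (ends : E → Sym2 V) (p : E → R) (hp : IsProbVec p)
    (o a₁ a₂ a₃ b : V) (h01 : o ≠ a₁) (h02 : o ≠ a₂) (h03 : o ≠ a₃) (h04 : o ≠ b)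
    (h12 : a₁ ≠ a₂) (h13 : a₁ ≠ a₃) (h14 : a₁ ≠ b) (h23 : a₂ ≠ a₃) (h24 : a₂ ≠ b) (h34 : a₃ ≠ b) :
    CaseOne.ZSplitI p ends o a₁ a₂ a₃ b := by
  obtain ⟨ι, h0, h1, h2, h3, h4⟩ :=
    exists_equiv_of_five hV o a₁ a₂ a₃ b h01 h02 h03 h04 h12 h13 h14 h23 h24 h34
  exact zSplitI_five ι ends p hp o a₁ a₂ a₃ b h0 h1 h2 h3 h4

/-- **(ii) on every graph with exactly five vertices, every five distinct marks, every weight vector.** -/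
theorem zSplitII_card5 (hV : Fintype.card V = 5) (ends : E → Sym2 V) (p : E → R) (hp : IsProbVec p)
    (o a₁ a₂ a₃ b : V) (h01 : o ≠ a₁) (h02 : o ≠ a₂) (h03 : o ≠ a₃) (h04 : o ≠ b)
    (h12 : a₁ ≠ a₂) (h13 : a₁ ≠ a₃) (h14 : a₁ ≠ b) (h23 : a₂ ≠ a₃) (h24 : a₂ ≠ b) (h34 : a₃ ≠ b) :
    CaseOne.ZSplitII p ends o a₁ a₂ a₃ b := by
  obtain ⟨ι, h0, h1, h2, h3, h4⟩ :=
    exists_equiv_of_five hV o a₁ a₂ a₃ b h01 h02 h03 h04 h12 h13 h14 h23 h24 h34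
  exact zSplitII_five ι ends p hp o a₁ a₂ a₃ b h0 h1 h2 h3 h4

/-- **(J1₁) on every graph with exactly five vertices, every five distinct marks, every weight vector.** -/
theorem jOneOne_card5 (hV : Fintype.card V = 5) (ends : E → Sym2 V) (p : E → R) (hp : IsProbVec p)
    (o a₁ a₂ a₃ b : V) (h01 : o ≠ a₁) (h02 : o ≠ a₂) (h03 : o ≠ a₃) (h04 : o ≠ b)
    (h12 : a₁ ≠ a₂) (h13 : a₁ ≠ a₃) (h14 : a₁ ≠ b) (h23 : a₂ ≠ a₃) (h24 : a₂ ≠ b) (h34 : a₃ ≠ b) :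
    CaseOne.JOneOne p ends o a₁ a₂ a₃ b := by
  obtain ⟨ι, h0, h1, h2, h3, h4⟩ :=
    exists_equiv_of_five hV o a₁ a₂ a₃ b h01 h02 h03 h04 h12 h13 h14 h23 h24 h34
  exact jOneOne_five ι ends p hp o a₁ a₂ a₃ b h0 h1 h2 h3 h4

end Theorems

end K5

end Summit.Ventures.PercRepro2
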